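import Mathlib

/-!
# `T4Continuum.ShellMeasureLandauExponent` — S14's LOCATED RESIDUALS WIRED: the (Ψ-an) binder of the Landau
# exponent from the displayed linearization data, the ray data through `H₁`, and the vanishing current
# (cell `pub-balaban`, sub-cell `t4`, spine estimate NE7c (node U5b); NE7c formalisation swarm, crew seat
# `b2b-balaban-t4-ne7c-formalise-leaf-02` gen 2; continues this lineage's locator row S18 (items (α), (γ)) and FINDING
# F-ne7cleaf02-1 on row S14 `ShellMeasureMinimiserBonds`; Mathlib-only, 0 `def`, 0 sorry)

HONEST FRAMING.  Finite four-torus programme, rung (B)+1 only — NOT infinite volume, NOT a mass gap, NOT the Clay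
problem, NOT summit progress; (B), `BetaPertHyp`, (B^μ) not consumed.  NE7c (`T4IndicatorShell.ShellWeightBound`) is
NOT PRINTED and NOT PROVED; «NE7c ⇐ the named binders».  This file discharges NO estimate of the audited series: it
turns three DISPLAYED-TYPE binders of row S14 (`ShellMeasureMinimiserBonds.classifierWitness_of_prop6Scheme(_landau)`,
the SM-L1 = (AN-bound)_j witness of END-II) into kernel consequences of finer binders of the SAME displayed type, over
abstract complex normed spaces (the modelling conventions of `B11Prop6Scheme`, DIVERGENCE D-B11-20: one abstract norm
on `𝒴` stands for max{|·|_{(−1)}, |∇·|_{(−2)}} of [Balaban1985Variational] (115)):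
* §1 (Ψ-an).  The Landau-gauge exponent of (47)/(112)/(174) is `Ψ(Y) = Y − H(D(Y))` with `H` LINEAR, bounded as in
  (46) («|HB| ≤ B₀(Lʲη)⁻¹|B|, |∇HB| ≤ B₀(Lʲη)⁻²|B| on Ω_j», [5] Thm 3.12 by reference — TYPE `‖H B‖ ≤ B₀‖B‖` in the
  max-norm), and `D` (the fixed point of (50), Sect. C) ANALYTIC of SECOND ORDER as in (55) («|D(A′)| … ≤ 4C₂|A′|²_{(−1)}.
  This implies that a power series expansion of D(A′) begins with second order terms», p. 286, «it is an analytic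
  function of A′», ibid.; Prop. 3 p. 289: (47) «defined and analytic for A′ satisfying (43) with ε₃ sufficiently small
  (e.g. 18C₂B₀dc₁(½)ε₃ ≤ 1, 2ε₃ ≤ c₄)» — TYPE `DifferentiableOn ℂ D (ball 0 r₀)` ∧ `‖D Y‖ ≤ C_D‖Y‖²` on that ball,
  `C_D = 4C₂`, for a radius `r₀` INSIDE Prop. 3's ε₃-domain — a located numeric coupling `ε₄ + a ≤ r₀ ≤ ε₃`, not
  discharged).  Renders `b2b-balaban-ref1/pages/1985-cmp102-variational-background/…-p009-x2.png`, `…-p010-x2.png`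
  (pp. 285–286: (43)–(57)) READ AS IMAGES by this seat; pp. 289, 294–295, 305–306 per this lineage's locator
  `HOME/b2b-balaban-t4-ne7c-formalise-leaf-02/XREAD-SM-L1-S14Binders.md` (GAPS C-ne7cleaf02-7).  CONSEQUENCES
  (kernel): `Ψ` holomorphic on the ball, `Ψ 0 = 0`, `‖Ψ Y‖ ≤ ‖Y‖ + B₀C_D‖Y‖² ≤ r₀ + B₀C_Dr₀²` — the shape of (57)
  «|A| ≤ |A′| + B₀(Lʲη)⁻¹4C₂|A′|²_{(−1)} < (ε₃ + 4C₂B₀ε₃²)(Lʲη)⁻¹» — i.e. EXACTLY the three hypotheses `hΨd`/`hΨ0`/`hΨb`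
  of S14 v1.1 with `ψ̄ := r₀ + B₀C_Dr₀²` (`≤ 2r₀` under `B₀C_Dr₀ ≤ 1`, the shape of (57)'s «< 2ε₃(Lʲη)⁻¹»).
* §2 RAY DATA (locator item (α)).  S14's background family is `𝔄_σ = H₁(B_σ)` (DICTIONARY, (103)/(111)) with `H₁`
  linear bounded by `B₀` ((103) TYPE) and `B_σ` the coarse field of the contraction ray — a HOLOMORPHIC family with
  `B_0 = 0` and `‖B_σ‖ < b` ((75) TYPE «|B| < 2dLC₁ε₁»; holomorphy BY REFERENCE to [6] (1.31)).  CONSEQUENCES: the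
  three hypotheses `h𝔄d`/`h𝔄0`/`h𝔄` of S14 with `a := B₀·b`; and for the chart ray `B_σ = Φ(σ • w)` (`Φ` holomorphic
  on `ball 0 r_Φ`, `Φ 0 = 0`, `‖Φ z‖ < b` there) the disc radius is the DISPLAYED quotient `Rad = r_Φ/‖w‖` — the
  locator's «Rad = READING» becomes an identity between two located sizes (analyticity radius of the coarse-field map
  vs. the size of the chart direction).
* §3 VANISHING CURRENT.  At a minimiser background the current term is ABSENT ((171) «𝔓*(U_k)J = 0», 𝔊 = G₁𝔓*,
  (175) has no 𝔊J): `J_σ := 0` inhabits S14's `hJd`/`hJ`/`hJ0` with `j = 0`.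
Composition with S14 v1.1 (`classifierWitness_of_prop6Scheme_landau`, p209025) is ONE CALL (its binders (Ψ-an), ray
data, current data are the conclusions below, by `exact`); it is left to the consumer / a sibling file so that this
module stays Mathlib-only.  WHAT REMAINS LOCATED after this file (unchanged in substance, finer in type): (P2), (P4),
(118)/(121); (46)/(103) bounds of `H`, `H₁`; (55) + analyticity of `D` on the ε₃-domain of Prop. 3; the coarse-field
map `Φ` of [6] (1.31) (analytic, `Φ(0) = 0`, bound (75)); k-uniformity sentences; the read-out and holonomy
dictionaries.  0 sorry, 0 `def`, no citation of the audited series as authority.  HONEST DEPENDENCY (cell): continuum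
YM on T⁴ ⇐ BetaPertH ∧ nine spine estimates (0/9 proved); BetaPertH ⇐ (D1) ∧ (D4) ∧ CAP+tail; G-an2-4 gates asym, D1
and NE2/3/4.
-/

noncomputable section

open Set Metric

namespace Summit.QuantumFields.BalabanUV.T4Continuum.ShellMeasureLandauExponent

variable {𝒴 𝒟 : Type*} [NormedAddCommGroup 𝒴] [NormedSpace ℂ 𝒴] [NormedAddCommGroup 𝒟] [NormedSpace ℂ 𝒟]

/-! ## §1 The Landau exponent `Ψ = id − H ∘ D` from the linearization data (46) + (55) -/

/-- (Ψ-an), analyticity: `H` continuous linear and `D` holomorphic on the ball ⟹ `Y ↦ Y − H (D Y)` holomorphic on the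
ball — the binder `hΨd` of `ShellMeasureMinimiserBonds.classifierWitness_of_prop6Scheme_landau`. [folklore] -/
theorem landau_differentiableOn (H : 𝒟 →L[ℂ] 𝒴) {D : 𝒴 → 𝒟} {r₀ : ℝ} (hDd : DifferentiableOn ℂ D (ball 0 r₀)) :
    DifferentiableOn ℂ (fun Y => Y - H (D Y)) (ball 0 r₀) :=
  differentiableOn_id.sub (H.differentiable.comp_differentiableOn hDd)

omit [NormedSpace ℂ 𝒴] [NormedSpace ℂ 𝒟] in
/-- second order ⟹ vanishing at the origin: `‖D Y‖ ≤ C_D‖Y‖²` near `0` forces `D 0 = 0`. [folklore] -/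
theorem map_zero_of_quadBound {D : 𝒴 → 𝒟} {C r₀ : ℝ} (hr₀ : 0 < r₀)
    (hD : ∀ Y ∈ ball (0 : 𝒴) r₀, ‖D Y‖ ≤ C * ‖Y‖ ^ 2) : D 0 = 0 := by
  have h := hD 0 (mem_ball_self hr₀)
  simpa using h

/-- (Ψ-an), flat centre: `Ψ 0 = 0` — the binder `hΨ0`. [folklore] -/
theorem landau_zero (H : 𝒟 →L[ℂ] 𝒴) {D : 𝒴 → 𝒟} {C r₀ : ℝ} (hr₀ : 0 < r₀)
    (hD : ∀ Y ∈ ball (0 : 𝒴) r₀, ‖D Y‖ ≤ C * ‖Y‖ ^ 2) : (fun Y => Y - H (D Y)) 0 = 0 := by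
  simp [map_zero_of_quadBound hr₀ hD]

/-- (Ψ-an), the bound in the shape of (57): `‖Y − H(D Y)‖ ≤ ‖Y‖ + B₀·C_D·‖Y‖²` on the ball. [folklore] -/
theorem landau_norm_le (H : 𝒟 →L[ℂ] 𝒴) {B₀ : ℝ} (hH : ∀ B, ‖H B‖ ≤ B₀ * ‖B‖) (hB₀ : 0 ≤ B₀) {D : 𝒴 → 𝒟}
    {C r₀ : ℝ} (hD : ∀ Y ∈ ball (0 : 𝒴) r₀, ‖D Y‖ ≤ C * ‖Y‖ ^ 2) :
    ∀ Y ∈ ball (0 : 𝒴) r₀, ‖Y - H (D Y)‖ ≤ ‖Y‖ + B₀ * C * ‖Y‖ ^ 2 := by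
  intro Y hY
  calc ‖Y - H (D Y)‖ ≤ ‖Y‖ + ‖H (D Y)‖ := norm_sub_le _ _
    _ ≤ ‖Y‖ + B₀ * (C * ‖Y‖ ^ 2) := by gcongr; exact (hH _).trans (by gcongr; exact hD Y hY)
    _ = ‖Y‖ + B₀ * C * ‖Y‖ ^ 2 := by ring

/-- (Ψ-an), the uniform bound on the ball: `‖Ψ Y‖ ≤ ψ̄ := r₀ + B₀·C_D·r₀²` — the binder `hΨb`. [folklore] -/
theorem landau_norm_le_const (H : 𝒟 →L[ℂ] 𝒴) {B₀ : ℝ} (hH : ∀ B, ‖H B‖ ≤ B₀ * ‖B‖) (hB₀ : 0 ≤ B₀) {D : 𝒴 → 𝒟}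
    {C r₀ : ℝ} (hC : 0 ≤ C) (hD : ∀ Y ∈ ball (0 : 𝒴) r₀, ‖D Y‖ ≤ C * ‖Y‖ ^ 2) :
    ∀ Y ∈ ball (0 : 𝒴) r₀, ‖Y - H (D Y)‖ ≤ r₀ + B₀ * C * r₀ ^ 2 := by
  intro Y hY
  have hYr : ‖Y‖ ≤ r₀ := (mem_ball_zero_iff.1 hY).le
  calc ‖Y - H (D Y)‖ ≤ ‖Y‖ + B₀ * C * ‖Y‖ ^ 2 := landau_norm_le H hH hB₀ hD Y hY
    _ ≤ r₀ + B₀ * C * r₀ ^ 2 := by gcongr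

/-- the three (Ψ-an) binders of S14 v1.1 in one statement: holomorphic on `ball 0 r₀`, `Ψ 0 = 0`, `‖Ψ‖ ≤ ψ̄`, with
`ψ̄ = r₀ + B₀C_Dr₀²`, from (46)-TYPE `hH` and (55)-TYPE `hDd`/`hD`. [folklore] -/
theorem landau_binders (H : 𝒟 →L[ℂ] 𝒴) {B₀ : ℝ} (hH : ∀ B, ‖H B‖ ≤ B₀ * ‖B‖) (hB₀ : 0 ≤ B₀) {D : 𝒴 → 𝒟}
    {C r₀ : ℝ} (hC : 0 ≤ C) (hr₀ : 0 < r₀) (hDd : DifferentiableOn ℂ D (ball 0 r₀))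
    (hD : ∀ Y ∈ ball (0 : 𝒴) r₀, ‖D Y‖ ≤ C * ‖Y‖ ^ 2) :
    DifferentiableOn ℂ (fun Y => Y - H (D Y)) (ball 0 r₀) ∧ (fun Y => Y - H (D Y)) 0 = 0 ∧
      ∀ Y ∈ ball (0 : 𝒴) r₀, ‖(fun Y => Y - H (D Y)) Y‖ ≤ r₀ + B₀ * C * r₀ ^ 2 :=
  ⟨landau_differentiableOn H hDd, landau_zero H hr₀ hD, landau_norm_le_const H hH hB₀ hC hD⟩

/-- the range statement of (57)'s shape: under `B₀·C_D·r₀ ≤ 1` the bound is `≤ 2r₀` («< 2ε₃»). [folklore] -/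
theorem landau_const_le_two_mul {B₀ C r₀ : ℝ} (hr₀ : 0 ≤ r₀) (hsmall : B₀ * C * r₀ ≤ 1) :
    r₀ + B₀ * C * r₀ ^ 2 ≤ 2 * r₀ := by
  have : B₀ * C * r₀ ^ 2 = (B₀ * C * r₀) * r₀ := by ring
  rw [this]
  nlinarith

/-! ## §2 The ray data through `H₁`: `𝔄_σ = H₁ (B_σ)` from a holomorphic coarse-field family -/

section Ray

variable {ℬ : Type*} [NormedAddCommGroup ℬ] [NormedSpace ℂ ℬ]

/-- **RAY DATA THROUGH `H₁`.**  A holomorphic coarse-field family `σ ↦ B_σ` on the disc `‖σ‖ < Rad` with `B_0 = 0`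
and `‖B_σ‖ < b` ((75) TYPE), pushed through a linear `H₁` with `‖H₁ B‖ ≤ B₀‖B‖` ((103) TYPE, `0 < B₀`), is S14's
background family: holomorphic, flat at `0`, `‖𝔄_σ‖ < a := B₀·b` — the binders `h𝔄d`/`h𝔄0`/`h𝔄` of
`ShellMeasureMinimiserBonds.solutionFamily_of_prop6Scheme` / `classifierWitness_of_prop6Scheme(_landau)`. [folklore] -/
theorem rayData_of_coarseField (H₁ : ℬ →L[ℂ] 𝒴) {B₀ : ℝ} (hH₁ : ∀ B, ‖H₁ B‖ ≤ B₀ * ‖B‖) (hB₀ : 0 < B₀)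
    {Bf : ℂ → ℬ} {Rad b : ℝ} (hBd : DifferentiableOn ℂ Bf (ball 0 Rad))
    (hB : ∀ σ ∈ ball (0 : ℂ) Rad, ‖Bf σ‖ < b) (hB0 : Bf 0 = 0) :
    DifferentiableOn ℂ (fun σ => H₁ (Bf σ)) (ball 0 Rad) ∧ (fun σ => H₁ (Bf σ)) 0 = 0 ∧
      ∀ σ ∈ ball (0 : ℂ) Rad, ‖H₁ (Bf σ)‖ < B₀ * b := by
  refine ⟨H₁.differentiable.comp_differentiableOn hBd, by simp [hB0], fun σ hσ => ?_⟩
  exact (hH₁ _).trans_lt (mul_lt_mul_of_pos_left (hB σ hσ) hB₀)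

/-- **THE CHART RAY.**  For `B_σ = Φ(σ • w)` with `Φ` holomorphic on `ball 0 r_Φ`, `Φ 0 = 0`, `‖Φ z‖ < b` there, and a
chart direction `w ≠ 0`: on the disc `‖σ‖ < Rad := r_Φ/‖w‖` the family is holomorphic, flat at `0`, bounded by `b` —
the disc radius is the DISPLAYED quotient of the coarse-field map's analyticity radius by the direction's size
(locator item (α): «Rad = READING» ↦ an identity between two located sizes). [folklore] -/
theorem coarseField_of_chartRay {E : Type*} [NormedAddCommGroup E] [NormedSpace ℂ E] {Φ : E → ℬ} {rΦ b : ℝ}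
    (hΦd : DifferentiableOn ℂ Φ (ball 0 rΦ)) (hΦ0 : Φ 0 = 0) (hΦ : ∀ z ∈ ball (0 : E) rΦ, ‖Φ z‖ < b) {w : E}
    (hw : w ≠ 0) :
    DifferentiableOn ℂ (fun σ : ℂ => Φ (σ • w)) (ball 0 (rΦ / ‖w‖)) ∧ (fun σ : ℂ => Φ (σ • w)) 0 = 0 ∧
      ∀ σ ∈ ball (0 : ℂ) (rΦ / ‖w‖), ‖Φ (σ • w)‖ < b := by
  have hn : 0 < ‖w‖ := norm_pos_iff.2 hw
  have hin : MapsTo (fun σ : ℂ => σ • w) (ball (0 : ℂ) (rΦ / ‖w‖)) (ball (0 : E) rΦ) := fun σ hσ => by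
    rw [mem_ball_zero_iff] at hσ ⊢
    rw [norm_smul]
    calc ‖σ‖ * ‖w‖ < rΦ / ‖w‖ * ‖w‖ := mul_lt_mul_of_pos_right hσ hn
      _ = rΦ := div_mul_cancel₀ rΦ hn.ne'
  refine ⟨hΦd.comp (differentiable_id.smul_const w).differentiableOn hin, by simp [hΦ0], fun σ hσ => ?_⟩
  exact hΦ _ (hin hσ)

/-- §2 in one call: the chart ray through the coarse-field map and `H₁` gives S14's ray data on the disc
`‖σ‖ < r_Φ/‖w‖` with `a = B₀·b`. [folklore] -/
theorem rayData_of_chartRay {E : Type*} [NormedAddCommGroup E] [NormedSpace ℂ E] (H₁ : ℬ →L[ℂ] 𝒴) {B₀ : ℝ}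
    (hH₁ : ∀ B, ‖H₁ B‖ ≤ B₀ * ‖B‖) (hB₀ : 0 < B₀) {Φ : E → ℬ} {rΦ b : ℝ}
    (hΦd : DifferentiableOn ℂ Φ (ball 0 rΦ)) (hΦ0 : Φ 0 = 0) (hΦ : ∀ z ∈ ball (0 : E) rΦ, ‖Φ z‖ < b) {w : E}
    (hw : w ≠ 0) :
    DifferentiableOn ℂ (fun σ : ℂ => H₁ (Φ (σ • w))) (ball 0 (rΦ / ‖w‖)) ∧
      (fun σ : ℂ => H₁ (Φ (σ • w))) 0 = 0 ∧ ∀ σ ∈ ball (0 : ℂ) (rΦ / ‖w‖), ‖H₁ (Φ (σ • w))‖ < B₀ * b := by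
  obtain ⟨hd, h0, hb⟩ := coarseField_of_chartRay hΦd hΦ0 hΦ hw
  exact rayData_of_coarseField H₁ hH₁ hB₀ (Bf := fun σ : ℂ => Φ (σ • w)) hd hb h0

end Ray

/-! ## §3 The vanishing current `J ≡ 0` at a minimiser background -/

/-- **`J ≡ 0`** inhabits S14's current data with bound `j = 0`: holomorphic (constant), `‖0‖ ≤ 0`, flat at `0`
((171)/(175): no `𝔊J` term at a minimiser background). [folklore] -/
theorem currentData_zero {𝒵 : Type*} [NormedAddCommGroup 𝒵] [NormedSpace ℂ 𝒵] (Rad : ℝ) :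
    DifferentiableOn ℂ (fun _ : ℂ => (0 : 𝒵)) (ball 0 Rad) ∧
      (∀ σ ∈ ball (0 : ℂ) Rad, ‖(fun _ : ℂ => (0 : 𝒵)) σ‖ ≤ 0) ∧ (fun _ : ℂ => (0 : 𝒵)) 0 = 0 :=
  ⟨differentiableOn_const _, fun _ _ => by simp, rfl⟩

/-- with `j = 0` the self-map condition (118) of S14 / `B11Prop6Scheme` loses its `B₀·j` term. [folklore] -/
theorem selfMap_118_of_zero_current {B₀ θ C₄ ε₄ a : ℝ}
    (h : θ * (ε₄ + a) + B₀ * C₄ * (ε₄ + a) ^ 2 ≤ ε₄) :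
    B₀ * 0 + θ * (ε₄ + a) + B₀ * C₄ * (ε₄ + a) ^ 2 ≤ ε₄ := by
  simpa using h

end Summit.QuantumFields.BalabanUV.T4Continuum.ShellMeasureLandauExponent
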